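import Literature.Dynamics.Ergodic.KolmogorovSinaiEntropyStatic
import Mathlib.Analysis.Subadditive

/-!
# Kolmogorov–Sinai entropy: the limit `h(T, ξ) = lim (1/n) Hₙ` and Walters Thm 4.12

Companion to `Literature/Dynamics/Ergodic/KolmogorovSinaiEntropy.lean` (definitions and
conventions there). Everything in this file is PROVED. Setting: a probability space `(Ω, μ)`, a
measure-preserving `T : Ω → Ω` (`MeasurePreserving T μ μ`), a finite measurable partition
`ξ : Ω → α`, and a sub-σ-algebra `m ≤ mΩ` which is **sub-invariant**, `T⁻¹m ⊆ m`, written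
`m.comap T ≤ m` (for `m = ⊥` this is automatic and gives the unconditional statements).

* `itinerary_add_eq_append_comp` — `⋁_{i<p+q} T^{-i}ξ = (⋁_{i<p} T^{-i}ξ) ∨ T^{-p}(⋁_{i<q} T^{-i}ξ)`
  (as a relabelling by `Fin.append`);
* `subadditive_condPartitionEntropy_itinerary` — `n ↦ H(⋁_{i<n} T^{-i}ξ | m)` is subadditive
  (Walters, proof of Cor 4.9.1: Thm 4.3 (viii) + (x); conditional form Downarowicz Fact 2.3.1
  via (1.6.33));
* `tendsto_condPartitionEntropy_itinerary_div`, `tendsto_partitionEntropy_itinerary_div` —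
  **Walters Cor 4.9.1 / Def 4.9**: `(1/n) H(⋁_{i<n} T^{-i}ξ | m) → h(T, ξ | m)` and
  `(1/n) H(⋁_{i<n} T^{-i}ξ) → h(T, ξ)`, by Fekete's lemma (Walters Thm 4.9 = Mathlib
  `Subadditive.tendsto_lim`), identifying our infimum definition with the limit;
* **Walters Thm 4.12 (i)** `h(T, ξ) ≤ H(ξ)` and **(iii)** `h(T, f ∘ ξ) ≤ h(T, ξ)` (monotonicity
  under refinement), with conditional versions, `h(T, ξ | m) ≤ h(T, ξ)` and `h(T | m) ≤ h(T)`.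

## References
* P. Walters, *An Introduction to Ergodic Theory*, GTM 79, Springer 1982, §4.4–4.5.
* T. Downarowicz, *Entropy in Dynamical Systems*, CUP 2011, §2.3.
-/

noncomputable section

open MeasureTheory Filter Topology Function Real
open scoped ENNReal

namespace Literature.Dynamics.Ergodic

variable {Ω α β : Type*}

/-! ### Algebra of itineraries -/

section ItineraryAlgebra

variable (T : Ω → Ω) (ξ : Ω → α)

/-- `⋁_{i<p+q} T^{-i}ξ = (⋁_{i<p} T^{-i}ξ) ∨ T^{-p} ⋁_{i<q} T^{-i}ξ`: the `(p+q)`-itinerary is the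
`p`-itinerary followed by the `q`-itinerary of `T^p ω` (relabelling by `Fin.append`).
[cite: Walters1982, proof of Cor 4.9.1] -/
theorem itinerary_add_eq_append_comp (p q : ℕ) :
    itinerary T ξ (p + q) = (fun w : (Fin p → α) × (Fin q → α) => Fin.append w.1 w.2) ∘
      fun ω => (itinerary T ξ p ω, (itinerary T ξ q ∘ T^[p]) ω) := by
  funext ω i
  refine Fin.addCases (fun j => ?_) (fun j => ?_) i
  · simp only [itinerary_apply, Fin.val_castAdd, comp_apply, Fin.append_left]
  · simp only [itinerary_apply, Fin.val_natAdd, comp_apply, Fin.append_right,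
      ← iterate_add_apply, add_comm]

/-- The `1`-itinerary is `ξ` itself (relabelled by the injective `a ↦ (a)`).
[cite: Walters1982, Def 4.9] -/
theorem itinerary_one_eq_comp : itinerary T ξ 1 = (fun (a : α) (_ : Fin 1) => a) ∘ ξ := by
  funext ω i
  simp only [itinerary_apply, Fin.val_eq_zero i, iterate_zero, id_eq, comp_apply]

/-- `a ↦ (a)` is injective (`Fin 1` is nonempty). [folklore] -/
theorem injective_const_fin_one : Injective fun (a : α) (_ : Fin 1) => a :=
  fun _ _ h => congr_fun h 0

/-- `ξ` is coarser than each `⋁_{i<n} T^{-i}ξ`, `n ≥ 1`: `ξ = (w ↦ w 0) ∘ itinerary T ξ (n+1)`.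
[cite: Walters1982, Thm 4.12 (iii)] -/
theorem comp_itinerary_succ_eval_zero (n : ℕ) :
    (fun w : Fin (n + 1) → α => w 0) ∘ itinerary T ξ (n + 1) = ξ := by
  funext ω
  simp only [comp_apply, itinerary_apply, Fin.val_zero, iterate_zero, id_eq]

end ItineraryAlgebra

/-! ### Elementary bounds: `h ≤ (1/n) Hₙ` -/

section Bounds

variable [Fintype α] {mΩ : MeasurableSpace Ω} {μ : Measure Ω}

/-- The sequence `(1/n) H(⋁_{i<n} T^{-i} ξ)` is bounded below (by `0`). [folklore] -/
theorem bddBelow_range_partitionEntropy_itinerary_div [IsZeroOrProbabilityMeasure μ]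
    (T : Ω → Ω) (ξ : Ω → α) :
    BddBelow (Set.range fun n : ℕ => partitionEntropy μ (itinerary T ξ (n + 1)) / (n + 1)) :=
  ⟨0, by rintro _ ⟨n, rfl⟩; exact div_nonneg (partitionEntropy_nonneg _) (by positivity)⟩

/-- The sequence `(1/n) H(⋁_{i<n} T^{-i} ξ | m)` is bounded below (by `0`). [folklore] -/
theorem bddBelow_range_condPartitionEntropy_itinerary_div [IsFiniteMeasure μ] (T : Ω → Ω)
    (ξ : Ω → α) (m : MeasurableSpace Ω) :
    BddBelow (Set.range fun n : ℕ =>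
      condPartitionEntropy μ (itinerary T ξ (n + 1)) m / (n + 1)) :=
  ⟨0, by rintro _ ⟨n, rfl⟩; exact div_nonneg (condPartitionEntropy_nonneg _ _) (by positivity)⟩

/-- `h(T, ξ) ≤ (1/n) H(⋁_{i<n} T^{-i} ξ)` for every `n ≥ 1` (the infimum is below each term;
Walters Thm 4.10: the terms decrease to `h(T, ξ)`). [cite: Walters1982, Thm 4.9 and Thm 4.10] -/
theorem dynEntropy_le_partitionEntropy_itinerary_div [IsZeroOrProbabilityMeasure μ]
    (T : Ω → Ω) (ξ : Ω → α) {n : ℕ} (hn : n ≠ 0) :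
    dynEntropy μ T ξ ≤ partitionEntropy μ (itinerary T ξ n) / n := by
  obtain ⟨k, rfl⟩ := Nat.exists_eq_succ_of_ne_zero hn
  push_cast
  exact ciInf_le (bddBelow_range_partitionEntropy_itinerary_div T ξ) k

/-- `h(T, ξ | m) ≤ (1/n) H(⋁_{i<n} T^{-i} ξ | m)` for every `n ≥ 1`.
[cite: Downarowicz2011, Def 2.3.3 with Fact 2.3.1] -/
theorem condDynEntropy_le_condPartitionEntropy_itinerary_div [IsFiniteMeasure μ] (T : Ω → Ω)
    (ξ : Ω → α) (m : MeasurableSpace Ω) {n : ℕ} (hn : n ≠ 0) :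
    condDynEntropy μ T ξ m ≤ condPartitionEntropy μ (itinerary T ξ n) m / n := by
  obtain ⟨k, rfl⟩ := Nat.exists_eq_succ_of_ne_zero hn
  push_cast
  exact ciInf_le (bddBelow_range_condPartitionEntropy_itinerary_div T ξ m) k

/-- Criterion for upper bounds on `h(T)`: it suffices to bound `h(T, ξ)` for `Fin k`-valued
measurable partitions. [cite: Walters1982, Def 4.10] -/
theorem kolmogorovSinaiEntropy_le_iff (μ : Measure Ω) (T : Ω → Ω) (c : ℝ≥0∞) :
    kolmogorovSinaiEntropy μ T ≤ c ↔
      ∀ (k : ℕ) (ξ : Ω → Fin k), Measurable ξ → ENNReal.ofReal (dynEntropy μ T ξ) ≤ c := by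
  simp only [kolmogorovSinaiEntropy, iSup_le_iff]

end Bounds

/-! ### Subadditivity and the Fekete limit (Walters Thm 4.9, Cor 4.9.1) -/

section Fekete

-- the sub-invariant σ-algebra `m` is declared before the ambient `mΩ` (instance resolution)
variable [Fintype α] [MeasurableSpace α] [MeasurableSingletonClass α] {m : MeasurableSpace Ω}
  {mΩ : MeasurableSpace Ω} {μ : Measure Ω} [IsProbabilityMeasure μ] {T : Ω → Ω} {ξ : Ω → α}

/-- Invariance step: for a sub-invariant `m` (`T⁻¹m ⊆ m`) and measure-preserving `T`,
`H(η ∘ T^i | m) ≤ H(η | m)` — indeed `H(η ∘ Tⁱ | m) ≤ H(η ∘ Tⁱ | T^{-i}m) = H(η | m)` by Walters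
Thm 4.3 (v) and (ix). [cite: Walters1982, Thm 4.3 (v) and (ix)] -/
theorem condPartitionEntropy_comp_iterate_le {η : Ω → β} [Fintype β] [MeasurableSpace β]
    [MeasurableSingletonClass β] (hT : MeasurePreserving T μ μ) (hm : m ≤ mΩ)
    (hinv : m.comap T ≤ m) (hη : Measurable η) (i : ℕ) :
    condPartitionEntropy μ (η ∘ T^[i]) m ≤ condPartitionEntropy μ η m := by
  have hi : m.comap T^[i] ≤ m := ((Measurable.of_comap_le hinv).iterate i).comap_le
  calc condPartitionEntropy μ (η ∘ T^[i]) m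
      ≤ condPartitionEntropy μ (η ∘ T^[i]) (m.comap T^[i]) := condPartitionEntropy_antitone hi _
    _ = condPartitionEntropy μ η m :=
        condPartitionEntropy_comp_of_measurePreserving (hT.iterate i) hm hη

/-- **Subadditivity** of `n ↦ H(⋁_{i<n} T^{-i}ξ | m)` for measure-preserving `T` and sub-invariant
`m` (Walters, proof of Cor 4.9.1: `a_{n+p} ≤ a_n + a_p` by Thm 4.3 (viii), (x); conditional
version: Downarowicz Fact 2.3.1 / (1.6.33)). [cite: Walters1982, Cor 4.9.1 (proof)] -/
theorem subadditive_condPartitionEntropy_itinerary (hT : MeasurePreserving T μ μ) (hm : m ≤ mΩ)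
    (hinv : m.comap T ≤ m) (hξ : Measurable ξ) :
    Subadditive fun n => condPartitionEntropy μ (itinerary T ξ n) m := by
  intro p q
  have hp : Measurable (itinerary T ξ p) := measurable_itinerary hT.measurable hξ p
  have hq : Measurable (itinerary T ξ q ∘ T^[p]) :=
    (measurable_itinerary hT.measurable hξ q).comp (hT.measurable.iterate p)
  calc condPartitionEntropy μ (itinerary T ξ (p + q)) m
      ≤ condPartitionEntropy μ
          (fun ω => (itinerary T ξ p ω, (itinerary T ξ q ∘ T^[p]) ω)) m := by
        rw [itinerary_add_eq_append_comp]
        exact condPartitionEntropy_comp_le (hp.prodMk hq) _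
    _ ≤ condPartitionEntropy μ (itinerary T ξ p) m +
          condPartitionEntropy μ (itinerary T ξ q ∘ T^[p]) m :=
        condPartitionEntropy_prod_le_add hp hq
    _ ≤ condPartitionEntropy μ (itinerary T ξ p) m + condPartitionEntropy μ (itinerary T ξ q) m :=
        add_le_add le_rfl (condPartitionEntropy_comp_iterate_le hT hm hinv
          (measurable_itinerary hT.measurable hξ q) p)

omit [MeasurableSpace α] [MeasurableSingletonClass α] [IsProbabilityMeasure μ] in
/-- Our infimum `h(T, ξ | m) = ⨅ₙ H_{n+1}/(n+1)` is Mathlib's `Subadditive.lim`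
(`= inf_{n≥1} Hₙ/n`) of the sequence `Hₙ = H(⋁_{i<n} T^{-i}ξ | m)`. [folklore] -/
theorem condDynEntropy_eq_lim
    (h : Subadditive fun n => condPartitionEntropy μ (itinerary T ξ n) m) :
    condDynEntropy μ T ξ m = h.lim := by
  unfold Subadditive.lim
  rw [condDynEntropy_def, iInf]
  congr 1
  ext x
  simp only [Set.mem_range, Set.mem_image, Set.mem_Ici]
  constructor
  · rintro ⟨k, rfl⟩
    exact ⟨k + 1, Nat.le_add_left 1 k, by push_cast; rfl⟩
  · rintro ⟨n, hn, rfl⟩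
    obtain ⟨k, rfl⟩ := Nat.exists_eq_add_of_le' hn
    exact ⟨k, by push_cast; rfl⟩

/-- **Walters Def 4.9 / Cor 4.9.1, conditional form** (Downarowicz Def 2.3.3): for
measure-preserving `T` and a sub-invariant sub-σ-algebra `m`,
`(1/n) H(⋁_{i<n} T^{-i}ξ | m) → h(T, ξ | m)` as `n → ∞` (Fekete's lemma, Walters Thm 4.9).
[cite: Downarowicz2011, Def 2.3.3] -/
theorem tendsto_condPartitionEntropy_itinerary_div (hT : MeasurePreserving T μ μ) (hm : m ≤ mΩ)
    (hinv : m.comap T ≤ m) (hξ : Measurable ξ) :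
    Tendsto (fun n : ℕ => condPartitionEntropy μ (itinerary T ξ n) m / n) atTop
      (𝓝 (condDynEntropy μ T ξ m)) := by
  have h := subadditive_condPartitionEntropy_itinerary hT hm hinv hξ
  rw [condDynEntropy_eq_lim h]
  exact h.tendsto_lim ⟨0, by
    rintro _ ⟨n, rfl⟩
    exact div_nonneg (condPartitionEntropy_nonneg _ _) n.cast_nonneg⟩

omit [MeasurableSpace α] [MeasurableSingletonClass α] in
/-- The trivial σ-algebra is sub-invariant under any map: `T⁻¹⊥ = ⊥`. [folklore] -/
theorem comap_bot_le (T : Ω → Ω) : (⊥ : MeasurableSpace Ω).comap T ≤ ⊥ := by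
  rw [MeasurableSpace.comap_bot]

/-- **Subadditivity** of `n ↦ H(⋁_{i<n} T^{-i}ξ)` (Walters, proof of Cor 4.9.1).
[cite: Walters1982, Cor 4.9.1 (proof)] -/
theorem subadditive_partitionEntropy_itinerary (hT : MeasurePreserving T μ μ) (hξ : Measurable ξ) :
    Subadditive fun n => partitionEntropy μ (itinerary T ξ n) := by
  have h := subadditive_condPartitionEntropy_itinerary hT bot_le (comap_bot_le T) hξ
  intro p q
  have := h p q
  simpa only [condPartitionEntropy_bot (measurable_itinerary hT.measurable hξ _)] using this

/-- **Walters Def 4.9 / Cor 4.9.1**: for measure-preserving `T`,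
`lim_n (1/n) H(⋁_{i<n} T^{-i}ξ)` exists and equals `h(T, ξ)` (our `dynEntropy`, defined as the
infimum; Walters Thm 4.9 = Fekete). [cite: Walters1982, Cor 4.9.1] -/
theorem tendsto_partitionEntropy_itinerary_div (hT : MeasurePreserving T μ μ) (hξ : Measurable ξ) :
    Tendsto (fun n : ℕ => partitionEntropy μ (itinerary T ξ n) / n) atTop
      (𝓝 (dynEntropy μ T ξ)) := by
  have h := tendsto_condPartitionEntropy_itinerary_div hT bot_le (comap_bot_le T) hξ
  rw [condDynEntropy_bot hT.measurable hξ] at h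
  refine h.congr fun n => ?_
  rw [condPartitionEntropy_bot (measurable_itinerary hT.measurable hξ _)]

end Fekete

/-! ### Walters Thm 4.12 (i), (iii) -/

section Thm412

variable [Fintype α] [Fintype β] [MeasurableSpace α] [MeasurableSingletonClass α]
  {m : MeasurableSpace Ω} {mΩ : MeasurableSpace Ω} {μ : Measure Ω} {T : Ω → Ω} {ξ : Ω → α}

omit [MeasurableSpace α] [MeasurableSingletonClass α] in
/-- `H(⋁_{i<1} T^{-i} ξ | m) = H(ξ | m)`. [folklore] -/
theorem condPartitionEntropy_itinerary_one (μ : Measure Ω) (T : Ω → Ω) (ξ : Ω → α)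
    (m : MeasurableSpace Ω) :
    condPartitionEntropy μ (itinerary T ξ 1) m = condPartitionEntropy μ ξ m := by
  rw [itinerary_one_eq_comp, condPartitionEntropy_comp_of_injective injective_const_fin_one]

omit [MeasurableSpace α] [MeasurableSingletonClass α] in
/-- `H(⋁_{i<1} T^{-i} ξ) = H(ξ)`. [folklore] -/
theorem partitionEntropy_itinerary_one (μ : Measure Ω) (T : Ω → Ω) (ξ : Ω → α) :
    partitionEntropy μ (itinerary T ξ 1) = partitionEntropy μ ξ := by
  rw [itinerary_one_eq_comp, partitionEntropy_comp_of_injective injective_const_fin_one]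

omit [MeasurableSpace α] [MeasurableSingletonClass α] in
/-- **Walters Thm 4.12 (i), conditional form**: `h(T, ξ | m) ≤ H(ξ | m)`.
[cite: Walters1982, Thm 4.12 (i)] -/
theorem condDynEntropy_le_condPartitionEntropy [IsFiniteMeasure μ] (T : Ω → Ω) (ξ : Ω → α)
    (m : MeasurableSpace Ω) : condDynEntropy μ T ξ m ≤ condPartitionEntropy μ ξ m := by
  have h := condDynEntropy_le_condPartitionEntropy_itinerary_div (μ := μ) T ξ m one_ne_zero
  rwa [Nat.cast_one, div_one, condPartitionEntropy_itinerary_one] at h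

omit [MeasurableSpace α] [MeasurableSingletonClass α] in
/-- **Walters Thm 4.12 (i)**: `h(T, ξ) ≤ H(ξ)`. [cite: Walters1982, Thm 4.12 (i)] -/
theorem dynEntropy_le_partitionEntropy [IsZeroOrProbabilityMeasure μ] (T : Ω → Ω) (ξ : Ω → α) :
    dynEntropy μ T ξ ≤ partitionEntropy μ ξ := by
  have h := dynEntropy_le_partitionEntropy_itinerary_div (μ := μ) T ξ one_ne_zero
  rwa [Nat.cast_one, div_one, partitionEntropy_itinerary_one] at h

/-- **Walters Thm 4.12 (iii), conditional form**: `h(T, ·| m)` is monotone under refinement,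
`h(T, f ∘ ξ | m) ≤ h(T, ξ | m)`. [cite: Walters1982, Thm 4.12 (iii)] -/
theorem condDynEntropy_comp_le [IsFiniteMeasure μ] (hT : Measurable T) (hξ : Measurable ξ)
    (f : α → β) : condDynEntropy μ T (f ∘ ξ) m ≤ condDynEntropy μ T ξ m := by
  refine ciInf_mono (bddBelow_range_condPartitionEntropy_itinerary_div T _ m) fun n => ?_
  rw [itinerary_comp]
  exact div_le_div_of_nonneg_right
    (condPartitionEntropy_comp_le (measurable_itinerary hT hξ _) _) (by positivity)

/-- **Walters Thm 4.12 (iii)**: `h(T, ·)` is monotone under refinement, `h(T, f ∘ ξ) ≤ h(T, ξ)`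
(`𝒜 ⊆ 𝒞 ⇒ h(T, 𝒜) ≤ h(T, 𝒞)`). [cite: Walters1982, Thm 4.12 (iii)] -/
theorem dynEntropy_comp_le [MeasurableSpace β] [MeasurableSingletonClass β]
    [IsProbabilityMeasure μ] (hT : Measurable T) (hξ : Measurable ξ) (f : α → β) :
    dynEntropy μ T (f ∘ ξ) ≤ dynEntropy μ T ξ := by
  rw [← condDynEntropy_bot hT hξ, ← condDynEntropy_bot hT ((measurable_of_finite f).comp hξ)]
  exact condDynEntropy_comp_le hT hξ f

/-- Conditioning decreases dynamical entropy: `h(T, ξ | m) ≤ h(T, ξ)` (from Walters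
Thm 4.3 (vi) termwise). [cite: Walters1982, Thm 4.3 (vi)] -/
theorem condDynEntropy_le_dynEntropy [IsProbabilityMeasure μ] (hT : Measurable T)
    (hξ : Measurable ξ) : condDynEntropy μ T ξ m ≤ dynEntropy μ T ξ := by
  refine ciInf_mono (bddBelow_range_condPartitionEntropy_itinerary_div T _ m) fun n => ?_
  exact div_le_div_of_nonneg_right
    (condPartitionEntropy_le_partitionEntropy (measurable_itinerary hT hξ _) m) (by positivity)

omit [Fintype α] [MeasurableSpace α] [MeasurableSingletonClass α] in
/-- `h(T | m) ≤ h(T)`: conditioning on a sub-σ-algebra decreases the entropy of `T`.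
[cite: Downarowicz2011, Def 4.1.5] -/
theorem condKolmogorovSinaiEntropy_le_kolmogorovSinaiEntropy [IsProbabilityMeasure μ]
    (hT : Measurable T) : condKolmogorovSinaiEntropy μ T m ≤ kolmogorovSinaiEntropy μ T :=
  iSup_mono fun _ => iSup_mono fun _ => iSup_mono fun hξ =>
    ENNReal.ofReal_le_ofReal (condDynEntropy_le_dynEntropy hT hξ)

omit [MeasurableSpace α] [MeasurableSingletonClass α] in
/-- Conditional dynamical entropy is antitone in the conditioning σ-algebra:
`m₁ ⊆ m₂ ⇒ h(T, ξ | m₂) ≤ h(T, ξ | m₁)` (from Walters Thm 4.3 (v) termwise).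
[cite: Walters1982, Thm 4.3 (v)] -/
theorem condDynEntropy_antitone [IsFiniteMeasure μ] {m₁ m₂ : MeasurableSpace Ω}
    (hm₁₂ : m₁ ≤ m₂) (T : Ω → Ω) (ξ : Ω → α) :
    condDynEntropy μ T ξ m₂ ≤ condDynEntropy μ T ξ m₁ := by
  refine ciInf_mono (bddBelow_range_condPartitionEntropy_itinerary_div T _ m₂) fun n => ?_
  exact div_le_div_of_nonneg_right (condPartitionEntropy_antitone hm₁₂ _) (by positivity)

end Thm412

end Literature.Dynamics.Ergodic
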